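import Mathlib

/-!
# The local design theorem: TPP letters + locally-killed words give a monoid-TPP family

Route `MatrixMultiplication/SemilatticeSTPP`, crux `Thesis` (stmt-MatrixMultiplication-5969),
line `localCapacity`, stub `stub_localDesignSound` (support file).

Source: H. Cohn, R. Kleinberg, B. Szegedy, C. Umans, *Group-theoretic algorithms for matrix
multiplication*, FOCS 2005 (arXiv:math/0511460), Theorem 33 ("a local strong USP gives a family
of triples with the simultaneous triple product property"), here in the language of an arbitrary
commutative monoid `C` instead of the group `Cyc_ℓ`.

Data: `k` LETTERS, letter `σ` being a block `(αg σ, βg σ, γg σ)` of shape `⟨ag σ, bg σ, cg σ⟩`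
inside `C` that is TPP in the iff-form (`αg ⟨σ,(s,t)⟩ * βg ⟨σ,(t',u)⟩ = γg ⟨σ,(s',u')⟩ ↔
s' = s ∧ t = t' ∧ u' = u`); `L` WORDS `row i : Fin n → Fin k`; and the LOCAL KILL: every ordered
triple of words `(i, j, l)` not all equal has a coordinate `c` at which no local values satisfy
`αg · βg = γg`.

`stub_localDesignSound`: these data give block maps `α β γ` into the power host `Fin n → C`,
block `i` having shape `⟨Π_c ag (row i c), Π_c bg (row i c), Π_c cg (row i c)⟩` (the word block is
the tensor product of its letters), satisfying the global monoid-TPP iff exactly in the index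
convention of `matMulDirectSum` (`z = (i,(s,u))`, `x = (i,(s,t))`, `y = (i,(t,u))`, compared
through `ℕ`-coercions).

Proof (CKSU's half page, verbatim): decode a global index `S : Fin (Π_c ag (row i c))` into its
letter coordinates with Mathlib's `finPiFinEquiv`, and put
`α ⟨i,(S,T)⟩ c := αg ⟨row i c, (S_c, T_c)⟩` etc. If `α x * β y = γ z` then, coordinatewise,
`αg · βg = γg` holds at every `c`, so the word triple `(x.1, y.1, z.1)` has no killing coordinate
and must be constant; then the letter iff at each coordinate identifies the decoded digits, hence
the global indices (injectivity of the decoding). Conversely a matched triple satisfies the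
relation letter by letter.
-/

-- (single-conjunct summit: the namespace repeats MatrixMultiplication)
set_option linter.dupNamespace false

namespace Summit.MatrixMultiplication.MatrixMultiplication.Theorems.SemilatticeSTPPThesis

/-- **The local design theorem** (CKSU 2005 Thm 33, monoid form). Letters that are TPP blocks
(iff-form) inside a commutative monoid `C` and a locally-killed family of `L` words
`row i : Fin n → Fin k` give a monoid-TPP family (iff-form, `matMulDirectSum` indexing) in the power
host `Fin n → C`, block `i` having shape `⟨Π_c ag (row i c), Π_c bg (row i c), Π_c cg (row i c)⟩`.
[cite: CohnKleinbergSzegedyUmans2005, Thm. 33 (p. 10), monoid form] -/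
theorem stub_localDesignSound :
    ∀ (C : Type) [CommMonoid C] (k : ℕ) (ag bg cg : Fin k → ℕ)
      (αg : (Σ σ : Fin k, Fin (ag σ) × Fin (bg σ)) → C)
      (βg : (Σ σ : Fin k, Fin (bg σ) × Fin (cg σ)) → C)
      (γg : (Σ σ : Fin k, Fin (ag σ) × Fin (cg σ)) → C)
      (L n : ℕ) (row : Fin L → Fin n → Fin k),
      (∀ (σ : Fin k) (s s' : Fin (ag σ)) (t t' : Fin (bg σ)) (u u' : Fin (cg σ)),
          αg ⟨σ, (s, t)⟩ * βg ⟨σ, (t', u)⟩ = γg ⟨σ, (s', u')⟩ ↔ (s' = s ∧ t = t' ∧ u' = u)) →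
      (∀ i j l : Fin L, (i ≠ j ∨ j ≠ l) → ∃ c : Fin n,
          ∀ (s : Fin (ag (row i c))) (t : Fin (bg (row i c))) (t' : Fin (bg (row j c)))
            (u : Fin (cg (row j c))) (s' : Fin (ag (row l c))) (u' : Fin (cg (row l c))),
            αg ⟨row i c, (s, t)⟩ * βg ⟨row j c, (t', u)⟩ ≠ γg ⟨row l c, (s', u')⟩) →
      ∃ (α : (Σ i : Fin L, Fin (∏ c, ag (row i c)) × Fin (∏ c, bg (row i c))) → (Fin n → C))
        (β : (Σ i : Fin L, Fin (∏ c, bg (row i c)) × Fin (∏ c, cg (row i c))) → (Fin n → C))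
        (γ : (Σ i : Fin L, Fin (∏ c, ag (row i c)) × Fin (∏ c, cg (row i c))) → (Fin n → C)),
        ∀ x y z, α x * β y = γ z ↔
          (z.1 = x.1 ∧ x.1 = y.1 ∧ (z.2.1 : ℕ) = x.2.1 ∧ (x.2.2 : ℕ) = y.2.1 ∧
            (z.2.2 : ℕ) = y.2.2) := by
  intro C _ k ag bg cg αg βg γg L n row hletter hkill
  -- the word blocks: decode the global indices letter by letter (`finPiFinEquiv`)
  refine ⟨fun x c => αg ⟨row x.1 c,
      ((finPiFinEquiv (n := fun c => ag (row x.1 c))).symm x.2.1 c,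
        (finPiFinEquiv (n := fun c => bg (row x.1 c))).symm x.2.2 c)⟩,
    fun y c => βg ⟨row y.1 c,
      ((finPiFinEquiv (n := fun c => bg (row y.1 c))).symm y.2.1 c,
        (finPiFinEquiv (n := fun c => cg (row y.1 c))).symm y.2.2 c)⟩,
    fun z c => γg ⟨row z.1 c,
      ((finPiFinEquiv (n := fun c => ag (row z.1 c))).symm z.2.1 c,
        (finPiFinEquiv (n := fun c => cg (row z.1 c))).symm z.2.2 c)⟩, ?_⟩
  rintro ⟨i, S, T⟩ ⟨j, T', U⟩ ⟨l, S', U'⟩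
  rw [funext_iff]
  simp only [Pi.mul_apply]
  constructor
  · intro hc
    -- (1) simultaneity: the word triple has no killing coordinate, so it is constant
    have hijl : i = j ∧ j = l := by
      by_contra hne
      have hne' : i ≠ j ∨ j ≠ l := by
        rcases eq_or_ne i j with hij | hij
        · exact Or.inr fun hjl => hne ⟨hij, hjl⟩
        · exact Or.inl hij
      obtain ⟨c, hk⟩ := hkill i j l hne'
      exact hk _ _ _ _ _ _ (hc c)
    obtain ⟨rfl, rfl⟩ := hijl
    -- (2) the matched triple: the letter iff identifies the digits, hence the indices
    have eS : S' = S := by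
      apply (finPiFinEquiv (n := fun c => ag (row i c))).symm.injective
      funext c
      exact ((hletter _ _ _ _ _ _ _).1 (hc c)).1
    have eT : T = T' := by
      apply (finPiFinEquiv (n := fun c => bg (row i c))).symm.injective
      funext c
      exact ((hletter _ _ _ _ _ _ _).1 (hc c)).2.1
    have eU : U' = U := by
      apply (finPiFinEquiv (n := fun c => cg (row i c))).symm.injective
      funext c
      exact ((hletter _ _ _ _ _ _ _).1 (hc c)).2.2
    subst eS eT eU
    exact ⟨rfl, rfl, rfl, rfl, rfl⟩
  · rintro ⟨h1, h2, h3, h4, h5⟩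
    subst h1 h2
    obtain rfl : S' = S := Fin.ext h3
    obtain rfl : T = T' := Fin.ext h4
    obtain rfl : U' = U := Fin.ext h5
    intro c
    exact (hletter _ _ _ _ _ _ _).2 ⟨rfl, rfl, rfl⟩

end Summit.MatrixMultiplication.MatrixMultiplication.Theorems.SemilatticeSTPPThesis
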